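import Literature.NumberTheory.Automorphic.Sweep1SymmetricPowerNewtonThorneProofs
import Literature.NumberTheory.ComplexMultiplication.SlotwiseIndependentOfLinearlyDisjoint
import HarnessLib

/-!
# Partial conjugations from Galois closures MEETING IN TOTALLY REAL FIELDS
# (for each number field `K_i` an automorphism of `ℂ` which is complex conjugation on every embedding of `K_i` and the
# identity on every embedding of the other `K_j`)

Companion of `NumberTheory/ComplexMultiplication/CMTypeRankPartialConjugation` (abstract: rank additivity
`rank(Σ) − 1 = Σ_i (rank(Φ_i) − 1)` for a family of CM types as soon as every slot carries a PARTIAL CONJUGATION — some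
`σ_i ∈ G` acting as `ρ` on `E_i` and trivially on the other slots) and of
`NumberTheory/ComplexMultiplication/SlotwiseIndependentOfLinearlyDisjoint` (the stronger regime: `τ = g` on `A`,
`τ = id` on `B` for EVERY `g`, from LINEAR DISJOINTNESS of `A` and `B`).  Here the prescribed automorphism is complex
conjugation only, and the price drops accordingly: for `G = Aut(ℂ)` acting on `E_i = Hom(K_i, ℂ)` by composition and
`ρ = starRingAut` (`Pohlmann1968.isCMTypeWith_conj`), a partial conjugation at the slot `i` exists as soon as complex
conjugation FIXES `L_i ∩ M_i` POINTWISE, where `L_i = normalClosure ℚ K_i ℂ` is the Galois closure of `K_i` in `ℂ` and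
`M_i = ∏_{j ≠ i} L_j` the compositum of the others — i.e. as soon as the (Galois, hence totally real or CM) field
`L_i ∩ M_i` is TOTALLY REAL; linear disjointness is the case `L_i ∩ M_i = ℚ`.

## What is proved (everything; no definition, no named fact, no `sorry`)

* **`exists_ringEquiv_apply_eq_of_normal`** (the engine) — for finite-dimensional NORMAL intermediate fields `A`, `B`
  of `ℂ/ℚ` and `g ∈ Aut(ℂ)` fixing `A ∩ B` pointwise there is `τ ∈ Aut(ℂ)` with `τ = g` on `A` and `τ = id` on `B`.
  Proof: inside the Galois extension `C = A·B` of `ℚ` the pair `(g|_A, id_B)` agrees on `A ∩ B`, so it is the pair of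
  restrictions of one `σ ∈ Gal(C/ℚ)` — the fibre-product description `Gal(C/ℚ) ↠ Gal(A/ℚ) ×_{Gal(A∩B/ℚ)} Gal(B/ℚ)`
  (Lang VI §1 Thm. 1.14; in the tree `NewtonThorne2021.exists_restrictNormal_eq`, from
  `Gal(C/A ∩ B) = Gal(C/A)·Gal(C/B)`); and `σ` extends from the countable field `C` to an automorphism of `ℂ`
  (`Motives.ZarhinLie.exists_ringEquiv_complex_comp_eq`).
* **`exists_partialConj_of_conj_apply_eq`** — for number fields `K_i` (`i ∈ I` finite): if complex conjugation fixes
  `L_i ∩ M_i` pointwise then some `σ ∈ Aut(ℂ)` satisfies `σ ∘ s = s̄` for every `s : K_i → ℂ` and `σ ∘ t = t` for every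
  `t : K_j → ℂ`, `j ≠ i`; **`forall_exists_partialConj_of_conj_apply_eq`** — the family form, which is EXACTLY the
  hypothesis `hconj` of `typeRank_sigmaType_add_card_eq_of_partialConj` for `(Aut ℂ, starRingAut)`;
* **`conj_apply_eq_of_exists_partialConj`** — the converse: a partial conjugation at `i` forces complex conjugation to
  fix `L_i ∩ M_i` pointwise (`σ` is conjugation on the compositum `L_i` of the `s(K_i)` and the identity on `M_i`), so the
  criterion is SHARP: **`exists_partialConj_iff_conj_apply_eq`**;
* **`forall_exists_partialConj_of_normalClosure_inf_eq_bot`**, **`SlotwiseIndependent.forall_exists_partialConj`** —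
  the linearly disjoint / independent regime is contained (trivial intersections are fixed by everything).
* (appended) **`conj_apply_eq_of_odd_finrank`** — a normal subfield of `ℂ` of ODD degree is totally real — and the
  criteria **`forall_exists_partialConj_of_odd_finrank_inf`**, **`forall_exists_partialConj_of_inf_le`** (intersections
  inside one real field), **`forall_exists_partialConj_pair`**, **`forall_exists_partialConj_pair_of_odd_finrank`** (two
  slots: conjugation fixes `L_{i₀} ∩ L_{i₁}`, e.g. of odd degree).

Why this matters (consumed in `Summits/HodgeConjecture/CorCM/RealIntersectionCMFieldsHodge`): two DISTINCT cyclic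
quartic CM fields with the same real quadratic subfield `ℚ(√d)`, or the CM fields `F·k_i` for a fixed totally real
Galois `F` and distinct imaginary quadratic `k_i`, are far from linearly disjoint (`L_i ∩ M_i ⊇ F`), their Galois actions
on embeddings are NOT independent, and yet `Hg(∏_i A_i) = ∏_i Hg(A_i)` for all CM types — the intersections are
totally real.

## References

* [Lang2002] S. Lang, *Algebra*, 3rd ed., GTM 211, VI §1 Thm. 1.14 (`Gal(EF/F) ≅ Gal(E/E ∩ F)`; the Galois group of a
  compositum as a fibre product), V §2 Thm. 2.8 (extension of embeddings into algebraically closed fields).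
* [Gordon1999HodgeAVSurvey] B. B. Gordon, *A survey of the Hodge conjecture for abelian varieties*, §3 Theorem (Imai,
  Murty), proof: "there is some `σ ∈ 𝒢` that acts as `+1` on `X(K^×_{1,1})` and `−1` on the other components".
* [NewtonThorneIHES2021b] J. Newton, J. A. Thorne, *Symmetric power functoriality for holomorphic modular forms, II*,
  Lemma 3.8 (the tree's source for the fibre-product lemma).
-/

noncomputable section

open IntermediateField

namespace Literature.NumberTheory.ComplexMultiplication

/-! ### Instance hygiene

For an intermediate field `S` of `ℂ/ℚ` there are two `ℚ`-algebra structures on `↥S`: Mathlib's `IntermediateField.algebra'`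
(restriction of the `ℚ`-action of `ℂ`; the one carried by `normalClosure`, `normal_iSup`, `restrictNormal`, …) and
`DivisionRing.toRatAlgebra` (any characteristic-zero division ring).  They are equal (`algebra_rat_subsingleton`) but
not reducibly, and bare instance search prefers the latter.  Statements below therefore spell the normality
hypotheses out as `@Normal ℚ ↥S _ _ (IntermediateField.algebra' S)` (the form Mathlib's instances provide), and the
proofs pin the `ℚ`-algebra structure of each subtype with a `letI`. -/

/-! ### The engine: gluing `g|_A` with `id_B` for normal `A`, `B ≤ ℂ` when `g` fixes `A ∩ B` -/

section Engine

variable {A B : IntermediateField ℚ ℂ}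

/-- A finite-dimensional intermediate field of `ℂ/ℚ` is countable. [folklore] -/
private theorem countable_of_finiteDimensional' (C : IntermediateField ℚ ℂ) [FiniteDimensional ℚ C] :
    Countable C :=
  Countable.of_equiv _ (Module.finBasis ℚ C).equivFun.toEquiv.symm

/-- An automorphism of `ℂ` fixes `ℚ`. [folklore] -/
private theorem ringEquiv_apply_algebraMap (g : ℂ ≃+* ℂ) (q : ℚ) : g (algebraMap ℚ ℂ q) = algebraMap ℚ ℂ q := by
  rw [eq_ratCast]
  exact map_ratCast g q

/-- **Gluing lemma.**  Let `A`, `B` be finite-dimensional intermediate fields of `ℂ/ℚ`, both NORMAL over `ℚ` (instances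
for Mathlib's `IntermediateField.algebra'`, as carried by `normalClosure` and `⨆`), and let `g ∈ Aut(ℂ)` fix `A ∩ B`
pointwise.  Then some `τ ∈ Aut(ℂ)` agrees with `g` on `A` and is the identity on `B`: in the Galois extension `C = A·B/ℚ`
the restrictions `(σ|_A, σ|_B)` of the `σ ∈ Gal(C/ℚ)` are exactly the pairs agreeing on `A ∩ B`
(`Gal(AB/B) ≅ Gal(A/A ∩ B)`), and every automorphism of the countable field `C` extends to `ℂ`.
[cite: Lang2002, VI §1 Thm. 1.14 and V §2 Thm. 2.8] -/
theorem exists_ringEquiv_apply_eq_of_normal [FiniteDimensional ℚ A] [FiniteDimensional ℚ B]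
    [@Normal ℚ A _ _ (IntermediateField.algebra' A)] [@Normal ℚ B _ _ (IntermediateField.algebra' B)]
    (g : ℂ ≃+* ℂ) (hg : ∀ x : ℂ, x ∈ A → x ∈ B → g x = x) :
    ∃ τ : ℂ ≃+* ℂ, (∀ a : ℂ, a ∈ A → τ a = g a) ∧ ∀ b : ℂ, b ∈ B → τ b = b := by
  have hAle : A ≤ A ⊔ B := le_sup_left
  have hBle : B ≤ A ⊔ B := le_sup_right
  -- pin the `ℚ`-algebra structures (see "Instance hygiene")
  letI iA : Algebra ℚ ↥A := IntermediateField.algebra' A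
  letI iB : Algebra ℚ ↥B := IntermediateField.algebra' B
  letI iAB : Algebra ℚ ↥(A ⊔ B) := IntermediateField.algebra' (A ⊔ B)
  letI iA' : Algebra ℚ ↥(IntermediateField.restrict hAle) := IntermediateField.algebra' _
  letI iB' : Algebra ℚ ↥(IntermediateField.restrict hBle) := IntermediateField.algebra' _
  -- the compositum `C = A ⊔ B`, finite Galois over `ℚ`
  haveI : Algebra.IsSeparable ℚ (↥(A ⊔ B)) := Algebra.IsAlgebraic.isSeparable_of_perfectField
  haveI : IsGalois ℚ (↥(A ⊔ B)) := ⟨⟩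
  -- `A`, `B` as (normal) intermediate fields `A'`, `B'` of `C`
  haveI : Normal ℚ (IntermediateField.restrict hAle) := Normal.of_algEquiv (IntermediateField.restrict_algEquiv hAle)
  haveI : Normal ℚ (IntermediateField.restrict hBle) := Normal.of_algEquiv (IntermediateField.restrict_algEquiv hBle)
  -- `g` as a `ℚ`-algebra automorphism of `ℂ`, restricted to the normal `C`, then to `A'`
  let gQ : ℂ ≃ₐ[ℚ] ℂ := AlgEquiv.ofRingEquiv (f := g) (ringEquiv_apply_algebraMap g)
  let gC : (↥(A ⊔ B)) ≃ₐ[ℚ] ↥(A ⊔ B) := gQ.restrictNormal ↥(A ⊔ B)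
  have hgC : ∀ x : ↥(A ⊔ B), ((gC x : ↥(A ⊔ B)) : ℂ) = g x := fun x =>
    AlgEquiv.restrictNormal_commutes gQ (↥(A ⊔ B)) x
  let σ₁ : (↥(IntermediateField.restrict hAle)) ≃ₐ[ℚ] ↥(IntermediateField.restrict hAle) :=
    gC.restrictNormal ↥(IntermediateField.restrict hAle)
  have hσ₁ : ∀ y : ↥(IntermediateField.restrict hAle),
      ((σ₁ y : ↥(IntermediateField.restrict hAle)) : ↥(A ⊔ B)) = gC (y : ↥(A ⊔ B)) := fun y =>
    AlgEquiv.restrictNormal_apply (IntermediateField.restrict hAle) gC y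
  -- the pair `(g|_A, id_B)` agrees on `A ∩ B`, hence comes from one `σ ∈ Gal(C/ℚ)` (Newton–Thorne L.3.8 form)
  obtain ⟨σ, hσA, hσB⟩ := Literature.NumberTheory.Automorphic.NewtonThorne2021.exists_restrictNormal_eq
    (K := ↥(A ⊔ B)) (IntermediateField.restrict hAle) (IntermediateField.restrict hBle) σ₁ 1 (by
      intro x h₁ h₂
      have e1 : (((σ₁ ⟨x, h₁⟩ : ↥(IntermediateField.restrict hAle)) : ↥(A ⊔ B)) : ℂ) = (x : ℂ) := by
        rw [hσ₁, hgC]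
        exact hg x ((IntermediateField.mem_restrict hAle x).1 h₁) ((IntermediateField.mem_restrict hBle x).1 h₂)
      rw [AlgEquiv.one_apply]
      exact Subtype.ext e1)
  -- `σ` acts as `g` on `A` and trivially on `B`
  have hσa : ∀ (a : ℂ) (ha : a ∈ A), ((σ ⟨a, hAle ha⟩ : ↥(A ⊔ B)) : ℂ) = g a := by
    intro a ha
    have hmem : (⟨a, hAle ha⟩ : ↥(A ⊔ B)) ∈ IntermediateField.restrict hAle :=
      (IntermediateField.mem_restrict hAle _).2 ha
    have h1 := AlgEquiv.restrictNormal_apply (IntermediateField.restrict hAle) σ ⟨_, hmem⟩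
    rw [hσA, hσ₁] at h1
    -- `h1 : gC ⟨a, _⟩ = σ ⟨a, _⟩` in `C`
    have h2 := congrArg Subtype.val h1
    rw [hgC] at h2
    exact h2.symm
  have hσb : ∀ (b : ℂ) (hb : b ∈ B), ((σ ⟨b, hBle hb⟩ : ↥(A ⊔ B)) : ℂ) = b := by
    intro b hb
    have hmem : (⟨b, hBle hb⟩ : ↥(A ⊔ B)) ∈ IntermediateField.restrict hBle :=
      (IntermediateField.mem_restrict hBle _).2 hb
    rw [(AlgEquiv.restrictNormal_eq_one_iff (IntermediateField.restrict hBle) σ).1 hσB _ hmem]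
  -- extend `σ` from the countable field `C` to `ℂ`
  haveI : Countable (↥(A ⊔ B)) := countable_of_finiteDimensional' (A ⊔ B)
  obtain ⟨τ, hτ⟩ := Literature.AlgebraicGeometry.Motives.ZarhinLie.exists_ringEquiv_complex_comp_eq
    (algebraMap (↥(A ⊔ B)) ℂ) ((algebraMap (↥(A ⊔ B)) ℂ).comp σ.toRingEquiv.toRingHom)
  refine ⟨τ, fun a ha => ?_, fun b hb => ?_⟩
  · exact (hτ ⟨a, hAle ha⟩).trans (hσa a ha)
  · exact (hτ ⟨b, hBle hb⟩).trans (hσb b hb)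

/-- Symmetric form of the gluing lemma: `τ = id` on `A` and `τ = g` on `B`. [cite: Lang2002, VI §1 Thm. 1.14 and V §2 Thm. 2.8] -/
theorem exists_ringEquiv_apply_eq_of_normal' [FiniteDimensional ℚ A] [FiniteDimensional ℚ B]
    [@Normal ℚ A _ _ (IntermediateField.algebra' A)] [@Normal ℚ B _ _ (IntermediateField.algebra' B)]
    (g : ℂ ≃+* ℂ) (hg : ∀ x : ℂ, x ∈ A → x ∈ B → g x = x) :
    ∃ τ : ℂ ≃+* ℂ, (∀ a : ℂ, a ∈ A → τ a = a) ∧ ∀ b : ℂ, b ∈ B → τ b = g b := by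
  obtain ⟨τ, h1, h2⟩ := exists_ringEquiv_apply_eq_of_normal (A := B) (B := A) g fun x hB hA => hg x hA hB
  exact ⟨τ, h2, h1⟩

end Engine

/-! ### Partial conjugations for number fields whose Galois closures meet in totally real fields -/

section Slotwise

variable {I : Type} {K : I → Type} [∀ i, Field (K i)] [∀ i, NumberField (K i)]

/-- The Galois closure of a number field in `ℂ` is normal over `ℚ` (Mathlib's `normalClosure` is a normal closure because
`ℂ` is algebraically closed; instance for `IntermediateField.algebra'`). [cite: Lang2002, V §3 Thm. 3.3] -/
theorem normal_normalClosure_complex (i : I) :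
    @Normal ℚ ↥(normalClosure ℚ (K i) ℂ) _ _ (IntermediateField.algebra' _) := by
  haveI := Algebra.IsAlgebraic.isNormalClosure_normalClosure (F := ℚ) (K := K i) (L := ℂ)
    fun x => IsAlgClosed.splits _
  exact IsNormalClosure.normal (K := K i)

/-- **A partial conjugation at the slot `i`.**  If complex conjugation fixes POINTWISE the intersection of the Galois
closure `L_i = normalClosure ℚ K_i ℂ` with the compositum `M_i = ∏_{j ≠ i} L_j` of the other Galois closures (i.e.
`L_i ∩ M_i` is totally real), then some `σ ∈ Aut(ℂ)` is complex conjugation on every embedding of `K_i` and the identity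
on every embedding of the `K_j`, `j ≠ i`: `σ ∘ s = s̄` (`s : K_i → ℂ`), `σ ∘ t = t` (`t : K_j → ℂ`) — Gordon's "`σ ∈ 𝒢`
that acts as `+1` on `X(K^×_{1,1})` and `−1` on the other components" (up to `σ ↦ ρσ`) for arbitrary number fields.
[cite: Gordon1999HodgeAVSurvey, §3 Theorem (proof)] -/
theorem exists_partialConj_of_conj_apply_eq [Finite I] (i : I)
    (hreal : ∀ x : ℂ, x ∈ normalClosure ℚ (K i) ℂ →
      x ∈ (⨆ j : {j : I // j ≠ i}, normalClosure ℚ (K j.1) ℂ) → starRingEnd ℂ x = x) :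
    ∃ σ : ℂ ≃+* ℂ, (∀ s : K i →+* ℂ, σ • s = (starRingAut : ℂ ≃+* ℂ) • s) ∧
      ∀ j, j ≠ i → ∀ s : K j →+* ℂ, σ • s = s := by
  haveI : ∀ j : I, @Normal ℚ ↥(normalClosure ℚ (K j) ℂ) _ _ (IntermediateField.algebra' _) :=
    normal_normalClosure_complex
  obtain ⟨τ, hA, hB⟩ := exists_ringEquiv_apply_eq_of_normal (A := normalClosure ℚ (K i) ℂ)
    (B := ⨆ j : {j : I // j ≠ i}, normalClosure ℚ (K j.1) ℂ) (starRingAut : ℂ ≃+* ℂ)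
    (fun x h₁ h₂ => by rw [starRingAut_apply, ← starRingEnd_apply]; exact hreal x h₁ h₂)
  refine ⟨τ, fun s => RingHom.ext fun x => ?_, fun j hj t => RingHom.ext fun x => hB _ ?_⟩
  · rw [ringEquiv_smul_apply, ringEquiv_smul_apply]
    exact hA _ (apply_mem_normalClosure i s x)
  · exact (le_iSup (fun j : {j : I // j ≠ i} => normalClosure ℚ (K j.1) ℂ) ⟨j, hj⟩ :
      normalClosure ℚ (K j) ℂ ≤ _) (apply_mem_normalClosure j t x)

/-- **The family form** — exactly the hypothesis `hconj` of `typeRank_sigmaType_add_card_eq_of_partialConj`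
(`CMTypeRankPartialConjugation`) for `G = Aut(ℂ)`, `ρ = starRingAut`, `E_i = Hom(K_i, ℂ)`: if for every `i` complex
conjugation fixes `L_i ∩ ∏_{j≠i} L_j` pointwise (the Galois closures MEET IN TOTALLY REAL FIELDS), every slot carries a
partial conjugation. [cite: Gordon1999HodgeAVSurvey, §3 Theorem (proof)] -/
theorem forall_exists_partialConj_of_conj_apply_eq [Finite I]
    (hreal : ∀ (i : I) (x : ℂ), x ∈ normalClosure ℚ (K i) ℂ →
      x ∈ (⨆ j : {j : I // j ≠ i}, normalClosure ℚ (K j.1) ℂ) → starRingEnd ℂ x = x) :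
    ∀ i : I, ∃ σ : ℂ ≃+* ℂ, (∀ s : K i →+* ℂ, σ • s = (starRingAut : ℂ ≃+* ℂ) • s) ∧
      ∀ j, j ≠ i → ∀ s : K j →+* ℂ, σ • s = s :=
  fun i => exists_partialConj_of_conj_apply_eq i (hreal i)

/-- **The linearly disjoint (Galois form) regime is contained**: if `L_i ∩ ∏_{j≠i} L_j = ℚ` for every `i`, every slot
carries a partial conjugation (rationals are fixed by conjugation). [cite: Lang2002, VI §1 Thm. 1.14] -/
theorem forall_exists_partialConj_of_normalClosure_inf_eq_bot [Finite I]
    (hinf : ∀ i : I, normalClosure ℚ (K i) ℂ ⊓ (⨆ j : {j : I // j ≠ i}, normalClosure ℚ (K j.1) ℂ) = ⊥) :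
    ∀ i : I, ∃ σ : ℂ ≃+* ℂ, (∀ s : K i →+* ℂ, σ • s = (starRingAut : ℂ ≃+* ℂ) • s) ∧
      ∀ j, j ≠ i → ∀ s : K j →+* ℂ, σ • s = s := by
  refine forall_exists_partialConj_of_conj_apply_eq fun i x h₁ h₂ => ?_
  have hx : x ∈ (⊥ : IntermediateField ℚ ℂ) := by
    rw [← hinf i]
    exact ⟨h₁, h₂⟩
  rw [IntermediateField.mem_bot] at hx
  obtain ⟨q, rfl⟩ := hx
  rw [eq_ratCast]
  exact map_ratCast (starRingEnd ℂ) q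

omit [∀ i, NumberField (K i)] in
/-- **Independence gives partial conjugations** (the instance `g := ρ` of `SlotwiseIndependent`), recorded for the
`Aut(ℂ)`-action on embeddings. [cite: Gordon1999HodgeAVSurvey, §3 Theorem (proof)] -/
theorem SlotwiseIndependent.forall_exists_partialConj
    (hind : SlotwiseIndependent (ℂ ≃+* ℂ) fun i => K i →+* ℂ) :
    ∀ i : I, ∃ σ : ℂ ≃+* ℂ, (∀ s : K i →+* ℂ, σ • s = (starRingAut : ℂ ≃+* ℂ) • s) ∧
      ∀ j, j ≠ i → ∀ s : K j →+* ℂ, σ • s = s :=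
  fun i => hind i starRingAut

/-! ### The converse: a partial conjugation forces a totally real intersection -/

/-- Two automorphisms of `ℂ` that agree on every embedding of `K_i` agree on the Galois closure of `K_i` in `ℂ` (the
compositum of the images of all embeddings, Mathlib `normalClosure_le_iff`). [cite: Lang2002, V §3 Thm. 3.3] -/
theorem apply_eq_of_forall_smul_eq (i : I) {σ σ' : ℂ ≃+* ℂ} (h : ∀ s : K i →+* ℂ, σ • s = σ' • s) {x : ℂ}
    (hx : x ∈ normalClosure ℚ (K i) ℂ) : σ x = σ' x := by
  -- the intermediate field where `σ` and `σ'` agree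
  let φ : ℂ →ₐ[ℚ] ℂ := (AlgEquiv.ofRingEquiv (f := σ) (ringEquiv_apply_algebraMap σ)).toAlgHom
  let ψ : ℂ →ₐ[ℚ] ℂ := (AlgEquiv.ofRingEquiv (f := σ') (ringEquiv_apply_algebraMap σ')).toAlgHom
  let D : IntermediateField ℚ ℂ :=
    ⟨AlgHom.equalizer φ ψ, fun y (hy : σ y = σ' y) => show σ y⁻¹ = σ' y⁻¹ by rw [map_inv₀, map_inv₀, hy]⟩
  have hle : normalClosure ℚ (K i) ℂ ≤ D := by
    rw [normalClosure_le_iff]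
    intro f y hy
    rw [AlgHom.mem_fieldRange] at hy
    obtain ⟨z, rfl⟩ := hy
    change σ (f z) = σ' (f z)
    have := RingHom.congr_fun (h f.toRingHom) z
    simp only [ringEquiv_smul_apply] at this
    exact this
  exact hle hx

/-- **Sharpness.**  If some `σ ∈ Aut(ℂ)` is complex conjugation on every embedding of `K_i` and the identity on every
embedding of the `K_j`, `j ≠ i`, then complex conjugation fixes `L_i ∩ ∏_{j≠i} L_j` pointwise (`σ` IS conjugation on
`L_i` and the identity on each `L_j`, `j ≠ i`, hence on their compositum). [cite: Lang2002, VI §1 Thm. 1.14] -/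
theorem conj_apply_eq_of_exists_partialConj (i : I) {σ : ℂ ≃+* ℂ}
    (hσ : ∀ s : K i →+* ℂ, σ • s = (starRingAut : ℂ ≃+* ℂ) • s) (hσ' : ∀ j, j ≠ i → ∀ s : K j →+* ℂ, σ • s = s)
    {x : ℂ} (h₁ : x ∈ normalClosure ℚ (K i) ℂ) (h₂ : x ∈ ⨆ j : {j : I // j ≠ i}, normalClosure ℚ (K j.1) ℂ) :
    starRingEnd ℂ x = x := by
  have hx₁ : σ x = starRingEnd ℂ x := by
    rw [apply_eq_of_forall_smul_eq i hσ h₁, starRingAut_apply, starRingEnd_apply]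
  -- on the compositum of the other Galois closures `σ` is the identity
  let φ : ℂ →ₐ[ℚ] ℂ := (AlgEquiv.ofRingEquiv (f := σ) (ringEquiv_apply_algebraMap σ)).toAlgHom
  let D : IntermediateField ℚ ℂ :=
    ⟨AlgHom.equalizer φ (AlgHom.id ℚ ℂ), fun y (hy : σ y = y) => show σ y⁻¹ = y⁻¹ by rw [map_inv₀, hy]⟩
  have hle : (⨆ j : {j : I // j ≠ i}, normalClosure ℚ (K j.1) ℂ) ≤ D := by
    refine iSup_le fun j => ?_
    intro y hy
    have hone : ∀ s : K j.1 →+* ℂ, σ • s = (1 : ℂ ≃+* ℂ) • s := fun s => by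
      rw [one_smul]; exact hσ' j.1 j.2 s
    change σ y = y
    have := apply_eq_of_forall_smul_eq j.1 hone hy
    simpa using this
  have hx₂ : σ x = x := hle h₂
  rw [← hx₁, hx₂]

/-- **The field-theoretic criterion for a partial conjugation is an equivalence**: some `σ ∈ Aut(ℂ)` is conjugation on
`Hom(K_i, ℂ)` and trivial on every `Hom(K_j, ℂ)`, `j ≠ i`, iff complex conjugation fixes `L_i ∩ ∏_{j≠i} L_j` pointwise
(iff that Galois subfield of `ℂ` is totally real). [cite: Lang2002, VI §1 Thm. 1.14] -/
theorem exists_partialConj_iff_conj_apply_eq [Finite I] (i : I) :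
    (∃ σ : ℂ ≃+* ℂ, (∀ s : K i →+* ℂ, σ • s = (starRingAut : ℂ ≃+* ℂ) • s) ∧
        ∀ j, j ≠ i → ∀ s : K j →+* ℂ, σ • s = s) ↔
      ∀ x : ℂ, x ∈ normalClosure ℚ (K i) ℂ →
        x ∈ (⨆ j : {j : I // j ≠ i}, normalClosure ℚ (K j.1) ℂ) → starRingEnd ℂ x = x :=
  ⟨fun ⟨_, hσ, hσ'⟩ _ h₁ h₂ => conj_apply_eq_of_exists_partialConj i hσ hσ' h₁ h₂,
    exists_partialConj_of_conj_apply_eq i⟩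

end Slotwise

/-! ### Sufficient conditions (appended 2026-08-21, same seat): odd degree, containment in a real field, two slots -/

section Criteria

/-- **A normal subfield of `ℂ` of ODD degree over `ℚ` is totally real**: complex conjugation restricts to an element of
order `≤ 2` of `Gal(M/ℚ)`, a group of odd order `[M : ℚ]`, hence to the identity — conjugation fixes `M` pointwise.
(Instance for Mathlib's `IntermediateField.algebra'`, as carried by `normalClosure`, `⨆`, `⊓`.) [cite: Lang2002, VI §1 Thm. 1.14] -/
theorem conj_apply_eq_of_odd_finrank (M : IntermediateField ℚ ℂ) [FiniteDimensional ℚ M]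
    [@Normal ℚ M _ _ (IntermediateField.algebra' M)] (hodd : Odd (Module.finrank ℚ M)) {x : ℂ} (hx : x ∈ M) :
    starRingEnd ℂ x = x := by
  letI iM : Algebra ℚ ↥M := IntermediateField.algebra' M
  haveI : Algebra.IsSeparable ℚ (↥M) := Algebra.IsAlgebraic.isSeparable_of_perfectField
  haveI : IsGalois ℚ (↥M) := ⟨⟩
  let cQ : ℂ ≃ₐ[ℚ] ℂ := AlgEquiv.ofRingEquiv (f := (starRingAut : ℂ ≃+* ℂ)) (ringEquiv_apply_algebraMap _)
  let c : (↥M) ≃ₐ[ℚ] ↥M := cQ.restrictNormal ↥M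
  have hc : ∀ y : ↥M, ((c y : ↥M) : ℂ) = starRingEnd ℂ y := fun y => AlgEquiv.restrictNormal_commutes cQ (↥M) y
  have hc2 : c ^ 2 = 1 := by
    rw [pow_two]
    refine AlgEquiv.ext fun y => Subtype.ext ?_
    rw [AlgEquiv.mul_apply, AlgEquiv.one_apply, hc, hc]
    exact Complex.conj_conj _
  have h1 : orderOf c = 1 :=
    Nat.eq_one_of_dvd_coprimes (Nat.coprime_two_left.2 hodd) (orderOf_dvd_of_pow_eq_one hc2)
      (by rw [← IsGalois.card_aut_eq_finrank]; exact orderOf_dvd_natCard c)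
  have hc1 : c = 1 := orderOf_eq_one_iff.1 h1
  have h2 := hc ⟨x, hx⟩
  rw [hc1, AlgEquiv.one_apply] at h2
  exact h2.symm

variable {I : Type} {K : I → Type} [∀ i, Field (K i)] [∀ i, NumberField (K i)]

/-- A subfield of a finite extension (inside `ℂ`) is finite. [folklore] -/
private theorem finiteDimensional_of_le' {E E' : IntermediateField ℚ ℂ} [FiniteDimensional ℚ E] (h : E' ≤ E) :
    FiniteDimensional ℚ E' :=
  FiniteDimensional.of_injective (IntermediateField.inclusion h).toLinearMap (IntermediateField.inclusion_injective h)

/-- **Odd-degree criterion.**  If for every `i` the field `L_i ∩ ∏_{j≠i} L_j` (`L_i` the Galois closure of `K_i` in `ℂ`)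
has ODD degree over `ℚ`, then every slot carries a partial conjugation (an odd-degree Galois field is totally real) —
e.g. `ℚ(ζ_7)` and `ℚ(ζ_7)⁺(√−3)` meet in the real cubic field `ℚ(ζ_7)⁺`; the CM fields `F·k_i` over a totally real
Galois `F` of odd degree with distinct imaginary quadratic `k_i ⊄ ∏_{j≠i} F k_j` meet in `F`.
[cite: Gordon1999HodgeAVSurvey, §3 Theorem (proof)] -/
theorem forall_exists_partialConj_of_odd_finrank_inf [Finite I]
    (hodd : ∀ i : I, Odd (Module.finrank ℚ
      ↥(normalClosure ℚ (K i) ℂ ⊓ ⨆ j : {j : I // j ≠ i}, normalClosure ℚ (K j.1) ℂ))) :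
    ∀ i : I, ∃ σ : ℂ ≃+* ℂ, (∀ s : K i →+* ℂ, σ • s = (starRingAut : ℂ ≃+* ℂ) • s) ∧
      ∀ j, j ≠ i → ∀ s : K j →+* ℂ, σ • s = s := by
  haveI : ∀ j : I, @Normal ℚ ↥(normalClosure ℚ (K j) ℂ) _ _ (IntermediateField.algebra' _) :=
    normal_normalClosure_complex
  refine forall_exists_partialConj_of_conj_apply_eq fun i x h₁ h₂ => ?_
  letI : Algebra ℚ ↥(normalClosure ℚ (K i) ℂ ⊓ ⨆ j : {j : I // j ≠ i}, normalClosure ℚ (K j.1) ℂ) :=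
    IntermediateField.algebra' _
  haveI : FiniteDimensional ℚ ↥(normalClosure ℚ (K i) ℂ ⊓ ⨆ j : {j : I // j ≠ i}, normalClosure ℚ (K j.1) ℂ) :=
    finiteDimensional_of_le' inf_le_left
  exact conj_apply_eq_of_odd_finrank _ (hodd i) ⟨h₁, h₂⟩

/-- **Containment criterion.**  If every `L_i ∩ ∏_{j≠i} L_j` is contained in one subfield `F ≤ ℂ` fixed pointwise by
complex conjugation (a real field, e.g. `ℚ(√5) ⊂ ℝ` for two cyclic quartic CM fields over `ℚ(√5)`), every slot carries a
partial conjugation. [cite: Gordon1999HodgeAVSurvey, §3 Theorem (proof)] -/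
theorem forall_exists_partialConj_of_inf_le [Finite I] (F : IntermediateField ℚ ℂ)
    (hF : ∀ x : ℂ, x ∈ F → starRingEnd ℂ x = x)
    (hle : ∀ i : I, normalClosure ℚ (K i) ℂ ⊓ (⨆ j : {j : I // j ≠ i}, normalClosure ℚ (K j.1) ℂ) ≤ F) :
    ∀ i : I, ∃ σ : ℂ ≃+* ℂ, (∀ s : K i →+* ℂ, σ • s = (starRingAut : ℂ ≃+* ℂ) • s) ∧
      ∀ j, j ≠ i → ∀ s : K j →+* ℂ, σ • s = s :=
  forall_exists_partialConj_of_conj_apply_eq fun i x h₁ h₂ => hF x (hle i ⟨h₁, h₂⟩)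

/-- Two slots: the compositum of "the other" Galois closures is the other Galois closure. [folklore] -/
private theorem iSup_subtype_ne_eq' {α : Type*} [CompleteLattice α] {i₀ i₁ : I} (h01 : i₀ ≠ i₁)
    (hI : ∀ j, j = i₀ ∨ j = i₁) (L : I → α) : (⨆ j : {j : I // j ≠ i₀}, L j.1) = L i₁ := by
  apply le_antisymm
  · refine iSup_le fun j => ?_
    rcases hI j.1 with h | h
    · exact (j.2 h).elim
    · rw [h]
  · exact le_iSup (fun j : {j : I // j ≠ i₀} => L j.1) ⟨i₁, fun h => h01 h.symm⟩

/-- **Two slots.**  For a family with exactly two slots `i₀ ≠ i₁` the hypothesis reads: complex conjugation fixes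
`L_{i₀} ∩ L_{i₁}` pointwise; then both slots carry partial conjugations. [cite: Gordon1999HodgeAVSurvey, §3 Theorem (proof)] -/
theorem forall_exists_partialConj_pair [Finite I] {i₀ i₁ : I} (h01 : i₀ ≠ i₁) (hI : ∀ j, j = i₀ ∨ j = i₁)
    (hreal : ∀ x : ℂ, x ∈ normalClosure ℚ (K i₀) ℂ → x ∈ normalClosure ℚ (K i₁) ℂ → starRingEnd ℂ x = x) :
    ∀ i : I, ∃ σ : ℂ ≃+* ℂ, (∀ s : K i →+* ℂ, σ • s = (starRingAut : ℂ ≃+* ℂ) • s) ∧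
      ∀ j, j ≠ i → ∀ s : K j →+* ℂ, σ • s = s := by
  refine forall_exists_partialConj_of_conj_apply_eq fun i x h₁ h₂ => ?_
  rcases hI i with rfl | rfl
  · rw [iSup_subtype_ne_eq' h01 hI (fun j => normalClosure ℚ (K j) ℂ)] at h₂
    exact hreal x h₁ h₂
  · rw [iSup_subtype_ne_eq' (Ne.symm h01) (fun j => (hI j).symm) (fun j => normalClosure ℚ (K j) ℂ)] at h₂
    exact hreal x h₂ h₁

/-- **Two slots, odd degree**: if `L_{i₀} ∩ L_{i₁}` has odd degree over `ℚ`, both slots carry partial conjugations.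
[cite: Gordon1999HodgeAVSurvey, §3 Theorem (proof)] -/
theorem forall_exists_partialConj_pair_of_odd_finrank [Finite I] {i₀ i₁ : I} (h01 : i₀ ≠ i₁)
    (hI : ∀ j, j = i₀ ∨ j = i₁)
    (hodd : Odd (Module.finrank ℚ ↥(normalClosure ℚ (K i₀) ℂ ⊓ normalClosure ℚ (K i₁) ℂ))) :
    ∀ i : I, ∃ σ : ℂ ≃+* ℂ, (∀ s : K i →+* ℂ, σ • s = (starRingAut : ℂ ≃+* ℂ) • s) ∧
      ∀ j, j ≠ i → ∀ s : K j →+* ℂ, σ • s = s := by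
  haveI : ∀ j : I, @Normal ℚ ↥(normalClosure ℚ (K j) ℂ) _ _ (IntermediateField.algebra' _) :=
    normal_normalClosure_complex
  letI : Algebra ℚ ↥(normalClosure ℚ (K i₀) ℂ ⊓ normalClosure ℚ (K i₁) ℂ) := IntermediateField.algebra' _
  haveI : FiniteDimensional ℚ ↥(normalClosure ℚ (K i₀) ℂ ⊓ normalClosure ℚ (K i₁) ℂ) :=
    finiteDimensional_of_le' inf_le_left
  exact forall_exists_partialConj_pair h01 hI fun x h₁ h₂ => conj_apply_eq_of_odd_finrank _ hodd ⟨h₁, h₂⟩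

end Criteria

end Literature.NumberTheory.ComplexMultiplication

end
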